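import Summits.CriticalPhenomena.CardyFormulaZ2.Theorems.CardyBoundaryCoulombGasHalfPlaneMarkDensityLawGapDualStepErase
import Summits.CriticalPhenomena.CardyFormulaZ2.Theorems.CardyBoundaryCoulombGasHalfPlaneMarkDensityLawSelfDualityIsoEscape

/-!
# `HalfPlaneMarkDensityLaw` (crux stmt-CriticalPhenomena-5661), line `Sketch`, cycle 2 (`GapClose`), lead c12-0:
# stub G3 `stub_armOfLeggedPath` — truncating a legged dual path of the erased configuration to a closed arm

`ω' = ω ∖ L`, `L` the edges with an endpoint in `{x₀ < α'}`.  A dual-open path of `ω'*` through faces of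
height `≥ 0` from the gap face `(b,0)` to `(b',0)`, `b' − b ≥ R`, preceded by the dual-open leg under
`(b,0)`, is cut at its first face at sup-distance `≥ R` from `(b,0)`: before the cut every face lies in
the open box `(b−R, b+R) × [−1, R)`, in particular (as `R ≤ b − α' + 1`) at abscissa `≥ α'`, so every
step of the initial segment is a dual-open step of `ω*` itself (`stub_dualStep_erase`), and the segment is
a closed arm of `ω` inside `faceBox b R` from the moat face `(b,−1)` (the dual alternative of
`Z2HalfPlane.oneArm`).
-/

noncomputable section

namespace Summit.CriticalPhenomena.CardyFormulaZ2.Cruxes.HalfPlaneMarkDensityLaw.SketchLine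

open Literature.Probability.Percolation Literature.Probability.LatticeModels
open Literature.Probability.Percolation.Z2HalfPlane (leg Far faceBox oneArm adj_leg mem_faceBox)
open MeasureTheory Filter Set SimpleGraph
open scoped Topology
open Summit.CriticalPhenomena.CardyFormulaZ2.Theorems.HalfPlaneMarkDensityLaw.Negative

namespace GapClose

/-- A vertex of a walk is its start or the head of one of its darts. [folklore] -/
theorem eq_or_exists_dart_of_mem_support {V : Type*} {G : SimpleGraph V} {u v z : V} (q : G.Walk u v)
    (hz : z ∈ q.support) : z = u ∨ ∃ d ∈ q.darts, d.snd = z := by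
  rw [← Walk.cons_tail_support, List.mem_cons, ← Walk.map_snd_darts, List.mem_map] at hz
  exact hz

/-- **Stub G3.** A legged dual path of `(ω ∖ L)*` from the gap face `(b,0)` to a face `(b',0)` with
`b' − b ≥ R` and `b − α' + 1 ≥ R` contains a closed arm of `ω` from the moat face `(b,−1)` to
sup-distance `R` inside `faceBox b R`. [folklore] -/
theorem stub_armOfLeggedPath :
    ∀ (ω : BondConfig (Site 2)) (α' b b' : ℤ) (R : ℕ),
      (R : ℤ) ≤ b' - b → (R : ℤ) ≤ b - α' + 1 →
      leg b ∈ dualConfig (ω \ {e | ∃ w ∈ e, w 0 < α'}) →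
      dualConfig (ω \ {e | ∃ w ∈ e, w 0 < α'}) ∈ openConnIn halfPlane ![b, 0] ![b', 0] →
      ∃ g : Site 2, Far R b g ∧ dualConfig ω ∈ openConnIn ↑(faceBox b R) ![b, -1] g := by
  intro ω α' b b' R hRb' hRα hleg hconn
  classical
  -- the dual path of faces of height `≥ 0`, as a lattice walk with `ω'*`-open edges
  obtain ⟨P, hPS, hPω⟩ := exists_walk_of_mem_openConnIn (fun e he => (mem_dualConfig_iff.1 he).1) hconn
  -- prepend the leg: a walk from the moat face `(b,-1)`
  set W : (zdGraph 2).Walk (![b, -1] : Site 2) ![b', 0] := Walk.cons (adj_leg b) P with hW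
  have hWS : ∀ z ∈ W.support, -1 ≤ z 1 := by
    intro z hz
    rw [hW, Walk.support_cons, List.mem_cons] at hz
    rcases hz with rfl | hz
    · simp
    · have := hPS z hz
      simp only [halfPlane, Set.mem_setOf_eq] at this
      omega
  have hWω : ∀ e ∈ W.edges, e ∈ dualConfig (ω \ {e | ∃ w ∈ e, w 0 < α'}) := by
    intro e he
    rw [hW, Walk.edges_cons, List.mem_cons] at he
    rcases he with rfl | he
    · exact hleg
    · exact hPω e he
  -- cut at the first face at sup-distance `≥ R`
  have hfar : Far R b (![b', 0] : Site 2) := by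
    left
    simp only [Matrix.cons_val_zero]
    exact le_trans hRb' (le_abs_self _)
  obtain ⟨g, q, hg, hq, hqd, hqs⟩ := SelfDual.exists_prefix_sat (Far R b) W hfar
  refine ⟨g, hg, mem_openConnIn_of_walk q ?_ ?_⟩
  · -- every face of the initial segment lies in `faceBox b R`
    intro z hz
    rw [Finset.mem_coe, mem_faceBox]
    rcases eq_or_exists_dart_of_mem_support q hz with rfl | ⟨d, hd, rfl⟩
    · simp
    · have h1 := hq d hd
      have hadj := d.adj
      have hfstS := hWS d.fst (hqs _ (q.dart_fst_mem_support_of_mem_darts hd))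
      have hsndS := hWS d.snd (hqs _ (q.dart_snd_mem_support_of_mem_darts hd))
      simp only [Far, not_or, not_le] at h1
      rcases stepKind_of_adj hadj with ⟨h0, h1'⟩ | ⟨h0, h1'⟩ | ⟨h1', h0⟩ | ⟨h1', h0⟩ <;>
        · obtain ⟨ha, hb⟩ := h1
          rw [abs_lt] at ha
          refine ⟨⟨?_, ?_⟩, ?_, ?_⟩ <;> omega
  · -- every step of the initial segment is a dual-open step of `ω*`
    intro e he
    rw [Walk.edges, List.mem_map] at he
    obtain ⟨d, hd, rfl⟩ := he
    have h1 := hq d hd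
    simp only [Far, not_or, not_le, abs_lt] at h1
    have hmem : s(d.fst, d.snd) ∈ dualConfig (ω \ {e | ∃ w ∈ e, w 0 < α'}) := by
      have : d.edge ∈ W.edges := by
        rw [Walk.edges, List.mem_map]
        exact ⟨d, hqd d hd, rfl⟩
      exact hWω _ this
    exact stub_dualStep_erase ω α' d.fst d.snd d.adj hmem (Or.inl (by omega))

end GapClose

end Summit.CriticalPhenomena.CardyFormulaZ2.Cruxes.HalfPlaneMarkDensityLaw.SketchLine
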